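import Summits.BirchSwinnertonDyer.BirchSwinnertonDyer.Theorems.SmallImageMuTransferMuTransferX9LocalExponentBadPrimes
import Summits.BirchSwinnertonDyer.BirchSwinnertonDyer.Theorems.SmallImageMuTransferMuTransferX9LocalTwistOperator
import Summits.BirchSwinnertonDyer.BirchSwinnertonDyer.Theorems.OneSidedTwistSqueezeX9KatoDivisibilityX9UnipotentFixedPointsPk
import Literature.NumberTheory.EllipticCurves.IwasawaTwistModPk
import Literature.NumberTheory.GaloisRepresentations.PPrimaryDevissage
import HarnessLib

/-!
# Line `graded_euler_loss` of crux `KatoDivisibilityX9` (stmt-BirchSwinnertonDyer-20547), stub 1a'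
# `stub_testCocyclePkLevelX9`, local clause at `v ∈ S ∖ {p}` — file 1 of 2: the UNIFORM ORDER BOUND
# `#H¹(K_v, 𝒯^{(k)}_J) ≤ #M^{2·p^m}` for the LEVEL-`p^k` Iwasawa twist `κ.twistModPk ρ hM J` (`p^k • M = 0`)
# at a place `v ∤ p`, for every `J`; and the `p`-group exponent lemma `T^[ε] = 0` on a finite `p`-group of
# order `≤ p^ε` for a nilpotent `T`

Seat `bsd-line-k6-p4` (prover-bsd-line-k6-p4-g5-0, 5th LEAD on the crux).  THEOREMS ONLY — no definition, no named
fact, no `sorry`; credits nothing (`--supports stmt-BirchSwinnertonDyer-20547 --as helper`).  This is the level-`p^k`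
port of `…SmallImageMuTransferMuTransferX9LocalExponentBadPrimes` (k6-g4, level `p`), needed because the v4 test class
`Ψ ∈ H¹(ℚ, 𝒯^{(d+1)}_L(E, κ⁻¹))` of `stub_testCocyclePkLevelX9` lives on the level-`p^{d+1}` carrier
`W.modPkTwist p (d+1) κ.invTwist L = κ.invTwist.twistModPk E[p^{d+1}] _ L`, and its local clause at `v ∈ S ∖ {p}`
(«`loc_v(T^ε Ψ) = 0`») is the statement that ONE `ε` kills `H¹(ℚ_v, 𝒯^{(d+1)}_L)` for every `L`.
* §0 `iterate_eq_zero_of_nilpotent_of_natCard_le_of_pow_smul` — a nilpotent additive endomorphism `T` of a finite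
  abelian group `B` with `p^k • B = 0` and `#B ≤ p^ε` satisfies `T^[ε] = 0` (induction on `k` along
  `0 → B[p] → B → B/B[p] → 0`, the `𝔽_p` case being k6-g4's Cayley–Hamilton lemma
  `iterate_eq_zero_of_nilpotent_of_natCard_le`).
* §1 `#H⁰(K_v, 𝒯^{(k)}_J) ≤ #M^{p^m}` for ANY `ρ`-trivial `g ∈ Γ_{K_v}` of depth `m`: `g` acts as `(1+S)^{p^m u}`,
  `p ∤ u` (`twistExponent_eq_prime_pow_mul_of_depth`), whose fixed points on `Fin J → M` number `≤ #M^{p^m}` at level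
  `p^k` (`…UnipotentFixedPointsPk.natCard_fixed_unipotentPow_le_of_coprime` — the replacement of the freshman's-dream
  step `(1+S)^{p^m} = 1 + S^{p^m}`, false modulo `p^k`).
* §2 `#H²(K_v, 𝒯^{(k)}_J) ≤ #M^{p^m}` if `g` moreover fixes `μ_{p^k}`: local duality `(2,0)` PROVED in the tree
  (`natCard_two_eq_natCard_invariants_homRep`, `#H² = #Hom_Γ(𝒯, μ_{p^k})`), coinvariants of `g`, `#Hom(B, ℤ/p^k) ≤ #B`.
* §3 `#H¹(K_v, 𝒯^{(k)}_J) ≤ #M^{2·p^m}` at `v ∤ p`: the PROVED prime-to-`p` Euler–Poincaré characteristic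
  `natCard_invariants_mul_natCard_two_eq`.
File 2 (`…LocalExponentPkUniform`) turns this into the uniform exponent `T_v^[2d·p^m] = 0` (`#M = p^d`), the element
`g` from any `τ` with `κ(res τ) ≠ 1`, the cyclotomic packaging over a finite set of places, and the
`twistModPkShiftEmbed ∘ twistModPkTruncate` spelling of the stub.  HONEST LABEL: closes nothing; BSD is not proved by
any of this; no summit statement is proved by this seat.
References: J. S. Milne, *Arithmetic Duality Theorems* (2006) I Cor. 2.3, Thm. 2.8 [MilneADT2006]; J.-P. Serre,
*Galois Cohomology* II §5.2, §5.7 [SerreGaloisCohomology1997]; B. Mazur, K. Rubin, Mem. AMS 799 (2004) Lemma 5.3.1,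
§5.3 [MazurRubin2004]; L. Washington, GTM 83 §13.1–13.2 [Washington1997].
-/

set_option linter.dupNamespace false
set_option autoImplicit false

noncomputable section

open scoped Classical ContRepresentation

universe u

namespace Summit.BirchSwinnertonDyer.BirchSwinnertonDyer.Theorems.OneSidedTwistSqueezeX9KatoDivisibilityX9LocalExponentPk

open Summit.BirchSwinnertonDyer.BirchSwinnertonDyer.Rank1Residual.LocalSplitPrime
open Summit.BirchSwinnertonDyer.BirchSwinnertonDyer.Theorems.OneSidedTwistSqueezeX9KatoDivisibilityX9UnipotentFixedPointsPk

/-! ## §0 The `p`-group exponent lemma -/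

section Algebra

open Function Literature.NumberTheory.GaloisRepresentations

/-- **A nilpotent endomorphism of a finite abelian `p`-group of order `≤ p^ε` satisfies `T^ε = 0`.**  For a finite
additive group `B` killed by `p^k`, an additive `T : B → B` some iterate of which vanishes, and `#B ≤ p^ε`:
`T^[ε] = 0`.  Induction on `k` along `0 → B[p] → B → B/B[p] → 0`: `B[p]` is an `𝔽_p`-space of order `p^f`, so
`T^[f] B[p] = 0` (Cayley–Hamilton, k6-g4's `iterate_eq_zero_of_nilpotent_of_natCard_le`); `B/B[p]` is killed by
`p^{k}` and has order `≤ p^{ε−f}`, so `T^[ε−f] B ⊆ B[p]` by induction; hence `T^[ε] B = 0`. [folklore] -/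
theorem iterate_eq_zero_of_nilpotent_of_natCard_le_of_pow_smul {p : ℕ} [hp : Fact p.Prime] :
    ∀ (k : ℕ) (B : Type u) [AddCommGroup B] [Finite B], (∀ b : B, p ^ k • b = 0) →
      ∀ (T : B →+ B) (n : ℕ), (∀ b, T^[n] b = 0) → ∀ (ε : ℕ), Nat.card B ≤ p ^ ε →
        ∀ b : B, T^[ε] b = 0 := by
  intro k
  induction k with
  | zero =>
    intro B _ _ hB T n _ ε _ b
    have hb : b = 0 := by simpa using hB b
    rw [hb]
    exact iterate_map_zero T ε
  | succ k ih =>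
    intro B _ _ hB T n hn ε hε b
    -- the `p`-torsion `N = B[p]`, stable under `T`
    let N : AddSubgroup B := (nsmulAddMonoidHom p : B →+ B).ker
    have hmemN : ∀ x, x ∈ N ↔ p • x = 0 := fun x => by
      rw [AddMonoidHom.mem_ker, nsmulAddMonoidHom_apply]
    have hTN : ∀ x ∈ N, T x ∈ N := fun x hx => by
      rw [hmemN] at hx ⊢
      rw [← map_nsmul, hx, map_zero]
    -- `T` on `N`: `T^[f] = 0` there, `#N = p^f`
    let TN : N →+ N := (T.comp N.subtype).codRestrict N (fun x => hTN x.1 x.2)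
    have hTN_iter : ∀ (j : ℕ) (x : N), ((TN^[j] x : N) : B) = T^[j] (x : B) := by
      intro j
      induction j with
      | zero => intro x; rfl
      | succ j ihj =>
        intro x
        rw [iterate_succ_apply', iterate_succ_apply', ← ihj]
        rfl
    have hNp : ∀ x : N, p • x = 0 := fun x => Subtype.ext (by
      rw [AddSubgroupClass.coe_nsmul, ZeroMemClass.coe_zero]
      exact (hmemN x.1).1 x.2)
    obtain ⟨f, hf⟩ := exists_card_eq_prime_pow N (fun x => ⟨1, by rw [pow_one]; exact hNp x⟩)
    have hN0 : ∀ x : N, TN^[f] x = 0 :=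
      iterate_eq_zero_of_nilpotent_of_natCard_le hNp TN (k := n)
        (fun x => Subtype.ext (by rw [hTN_iter, ZeroMemClass.coe_zero]; exact hn x)) hf.le
    -- `T` on `B/N`: nilpotent, `B/N` killed by `p^k`, `#(B/N) ≤ p^{ε-f}`
    have hle : N ≤ N.comap T := fun x hx => hTN x hx
    let TQ : B ⧸ N →+ B ⧸ N := QuotientAddGroup.map N N T hle
    have hTQ_iter : ∀ (j : ℕ) (x : B),
        TQ^[j] (QuotientAddGroup.mk' N x) = QuotientAddGroup.mk' N (T^[j] x) := by
      intro j
      induction j with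
      | zero => intro x; rfl
      | succ j ihj =>
        intro x
        rw [iterate_succ_apply', iterate_succ_apply', ihj]
        rfl
    have hQ : ∀ z : B ⧸ N, p ^ k • z = 0 := by
      intro z
      induction z using QuotientAddGroup.induction_on with
      | H x =>
        rw [← QuotientAddGroup.mk_nsmul, QuotientAddGroup.eq_zero_iff]
        change nsmulAddMonoidHom p (p ^ k • x) = 0
        rw [nsmulAddMonoidHom_apply, ← mul_nsmul', ← pow_succ', hB]
    have hQn : ∀ z : B ⧸ N, TQ^[n] z = 0 := by
      intro z
      induction z using QuotientAddGroup.induction_on with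
      | H x =>
        change TQ^[n] (QuotientAddGroup.mk' N x) = 0
        rw [hTQ_iter, hn, map_zero]
    have hcardB : Nat.card B = Nat.card (B ⧸ N) * Nat.card N := N.card_eq_card_quotient_mul_card_addSubgroup
    have hQpos : 0 < Nat.card (B ⧸ N) := Nat.card_pos
    have hfε : f ≤ ε := by
      by_contra h
      have h1 : p ^ ε < p ^ f := Nat.pow_lt_pow_right hp.out.one_lt (by omega)
      have h2 : p ^ f ≤ Nat.card B := by
        rw [hcardB, hf]
        exact Nat.le_mul_of_pos_left _ hQpos
      omega
    have hQcard : Nat.card (B ⧸ N) ≤ p ^ (ε - f) := by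
      have h1 : Nat.card (B ⧸ N) * p ^ f ≤ p ^ (ε - f) * p ^ f := by
        rw [← pow_add, Nat.sub_add_cancel hfε, ← hf, ← hcardB]
        exact hε
      exact Nat.le_of_mul_le_mul_right h1 (pow_pos hp.out.pos f)
    have hQ0 : ∀ z : B ⧸ N, TQ^[ε - f] z = 0 := ih (B ⧸ N) hQ TQ n hQn (ε - f) hQcard
    -- conclusion: `T^[ε-f] b ∈ N`, then `T^[f]` kills it
    have hmem : T^[ε - f] b ∈ N := by
      have h := hQ0 (QuotientAddGroup.mk' N b)
      rw [hTQ_iter] at h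
      exact (QuotientAddGroup.eq_zero_iff _).1 h
    have h2 : T^[f] (T^[ε - f] b) = 0 := by
      have h := congrArg Subtype.val (hN0 ⟨_, hmem⟩)
      rw [hTN_iter] at h
      exact h
    rw [show ε = f + (ε - f) by omega, iterate_add_apply, h2]

end Algebra

open CategoryTheory ContinuousCohomology Function Field ValuativeRel NumberField IsDedekindDomain
open Literature.NumberTheory.GaloisRepresentations
open Literature.NumberTheory.GaloisRepresentations.IsNonarchimedeanLocalField
open _root_.TopRep
open Literature.NumberTheory.GaloisCohomology
open Literature.NumberTheory.EllipticCurves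

/-! ## §1 Invariants: `#H⁰(K_v, 𝒯^{(k)}_J) ≤ #M^{p^m}` for ANY `ρ`-trivial element of depth `m` -/

section Invariants

variable {K : Type u} [Field K] [NumberField K] {M : Type u} [AddCommGroup M] [TopologicalSpace M]
  [DiscreteTopology M] [Finite M] (ρ : DiscreteGaloisModule K M) {p : ℕ} [Fact p.Prime] {k : ℕ}
  (hM : ∀ x : M, p ^ k • x = 0) (κ : ZpExtension K p) (J : ℕ) (v : HeightOneSpectrum (𝓞 K))

omit [Finite M] in
/-- **At an `E`-split element** (`ρ(res g) = 1`) the local level-`p^k` twist acts by the unipotent operator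
`(1+S)^{κ(res g)}` alone (exponent read at the definitional level `J + k`). [cite: MazurRubin2004, §5.3]
[cite: Washington1997, §13.1–§13.2] -/
theorem toLocal_twistModPk_apply_of_apply_eq_one {g : absoluteGaloisGroup (v.adicCompletion K)}
    (hg : ρ (absGaloisRestrict K (v.adicCompletion K) g) = 1) (x : Fin J → M) :
    GaloisRep.toLocal v (κ.twistModPk ρ hM J) g x =
      unipotentPow M J (κ.twistExponent (J + k) (absGaloisRestrict K (v.adicCompletion K) g)) x := by
  change κ.twistModPk ρ hM J (absGaloisRestrict K (v.adicCompletion K) g) x = _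
  rw [ZpExtension.twistModPk_apply]
  congr 1
  funext i
  rw [hg, Module.End.one_apply]

/-- **Fixed points of a `ρ`-trivial element of depth `m` on `𝒯^{(k)}_J` are few, uniformly in `J`.**  For
`g ∈ Γ_{K_v}` with `ρ(res g) = 1` and `res g ∈ Gal(K̄/K_m) ∖ Gal(K̄/K_{m+1})`:
`#{x ∈ 𝒯^{(k)}_J : g·x = x} ≤ #M^{p^m}` (`g` acts as `(1+S)^{p^m u}`, `p ∤ u`; at level `p^k` the fixed points are
no longer `𝒯_J[S^{p^m}]`, but their number obeys the same bound, `natCard_fixed_unipotentPow_le_of_coprime`).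
[cite: Washington1997, §13.1–§13.2] [cite: MazurRubin2004, Lemma 5.3.1] -/
theorem natCard_fixedPoints_toLocal_twistModPk_le_of_depth
    {g : absoluteGaloisGroup (v.adicCompletion K)}
    (hg : ρ (absGaloisRestrict K (v.adicCompletion K) g) = 1) {m : ℕ}
    (hgm : absGaloisRestrict K (v.adicCompletion K) g ∈ κ.layerSubgroup m)
    (hgm' : absGaloisRestrict K (v.adicCompletion K) g ∉ κ.layerSubgroup (m + 1)) :
    Nat.card {x : Fin J → M // GaloisRep.toLocal v (κ.twistModPk ρ hM J) g x = x} ≤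
      Nat.card M ^ (p ^ m) := by
  have hMpos : 0 < Nat.card M := Nat.card_pos
  by_cases hm : m + 1 ≤ J + k
  · obtain ⟨u, hu, hb⟩ := twistExponent_eq_prime_pow_mul_of_depth κ hm hgm hgm'
    refine le_trans (le_of_eq (Nat.card_congr (Equiv.subtypeEquivRight fun x => ?_)))
      (natCard_fixed_unipotentPow_le_of_coprime (J := J) hM (m := m) hu)
    rw [toLocal_twistModPk_apply_of_apply_eq_one ρ hM κ J v hg, hb]
  · have hJm : J ≤ p ^ m := by
      have := Nat.lt_pow_self (Fact.out : p.Prime).one_lt (n := m)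
      omega
    calc Nat.card {x : Fin J → M // GaloisRep.toLocal v (κ.twistModPk ρ hM J) g x = x}
        ≤ Nat.card (Fin J → M) :=
          Nat.card_le_card_of_injective (fun x => x.1) Subtype.val_injective
      _ = Nat.card M ^ J := natCard_coordinateModule J
      _ ≤ Nat.card M ^ (p ^ m) := Nat.pow_le_pow_right hMpos hJm

/-- **Uniform bound on the local invariants of the level-`p^k` twist**: for `g ∈ Γ_{K_v}` with `ρ(res g) = 1` of
depth `m` in the `ℤ_p`-tower of `κ`, and EVERY level `J`: `#H⁰(K_v, 𝒯^{(k)}_J) ≤ #M^{p^m}`.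
[cite: Washington1997, §13.1–§13.2] [cite: MazurRubin2004, Lemma 5.3.1] -/
theorem natCard_invariants_toLocal_twistModPk_le_of_depth
    {g : absoluteGaloisGroup (v.adicCompletion K)}
    (hg : ρ (absGaloisRestrict K (v.adicCompletion K) g) = 1) {m : ℕ}
    (hgm : absGaloisRestrict K (v.adicCompletion K) g ∈ κ.layerSubgroup m)
    (hgm' : absGaloisRestrict K (v.adicCompletion K) g ∉ κ.layerSubgroup (m + 1)) :
    Nat.card (GaloisRep.toLocal v (κ.twistModPk ρ hM J)).toTopRep.ρ.invariants ≤
      Nat.card M ^ (p ^ m) :=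
  (Nat.card_le_card_of_injective
    (fun x : (GaloisRep.toLocal v (κ.twistModPk ρ hM J)).toTopRep.ρ.invariants =>
      (⟨x.1, x.2 g⟩ : {x : Fin J → M // GaloisRep.toLocal v (κ.twistModPk ρ hM J) g x = x}))
    (fun x y hxy => Subtype.ext (by simpa using congrArg Subtype.val hxy))).trans
    (natCard_fixedPoints_toLocal_twistModPk_le_of_depth ρ hM κ J v hg hgm hgm')

end Invariants

/-! ## §2 `#H²(K_v, 𝒯^{(k)}_J) ≤ #M^{p^m}`: local duality in bidegree `(2, 0)` (PROVED in the tree) and the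
coinvariants of `g` -/

section HTwo

variable {K : Type u} [Field K] [NumberField K] {M : Type u} [AddCommGroup M] [TopologicalSpace M]
  [DiscreteTopology M] [Finite M] (ρ : DiscreteGaloisModule K M) {p : ℕ} [Fact p.Prime] {k : ℕ}
  (hM : ∀ x : M, p ^ k • x = 0) (κ : ZpExtension K p) (J : ℕ) (v : HeightOneSpectrum (𝓞 K))

/-- **Uniform bound on `H²` at level `p^k`.**  For `g ∈ Γ_{K_v}` as in §1 which moreover fixes the `p^k`-th roots of
unity of `K̄_v` (`hμ`), and every level `J`: `#H²(K_v, 𝒯^{(k)}_J) ≤ #M^{p^m}` — local duality in bidegree `(2, 0)`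
(`natCard_two_eq_natCard_invariants_homRep`: `#H²(K_v, 𝒯) = #Hom_{Γ_{K_v}}(𝒯, μ_{p^k})`), an equivariant `f`
factors through the co-invariants `𝒯/(g − 1)𝒯`, of order `#ker(g − 1) ≤ #M^{p^m}` (§1), and `#Hom(B, μ_{p^k}) ≤ #B`.
[cite: MilneADT2006, Ch. I, Cor. 2.3] [cite: SerreGaloisCohomology1997, II §5.2 Thm. 2] -/
theorem natCard_galoisCohomology_two_toLocal_twistModPk_le_of_depth
    {g : absoluteGaloisGroup (v.adicCompletion K)}
    (hg : ρ (absGaloisRestrict K (v.adicCompletion K) g) = 1)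
    (hμ : ∀ ζ : (AlgebraicClosure (v.adicCompletion K))ˣ, ζ ^ (p ^ k) = 1 → g • ζ = ζ) {m : ℕ}
    (hgm : absGaloisRestrict K (v.adicCompletion K) g ∈ κ.layerSubgroup m)
    (hgm' : absGaloisRestrict K (v.adicCompletion K) g ∉ κ.layerSubgroup (m + 1)) :
    Nat.card (galoisCohomology (GaloisRep.toLocal v (κ.twistModPk ρ hM J)) 2) ≤ Nat.card M ^ (p ^ m) := by
  set F := v.adicCompletion K
  haveI : CharZero F := charZero_adicCompletion v
  haveI : NeZero (p ^ k) := ⟨pow_ne_zero _ (Fact.out : p.Prime).ne_zero⟩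
  set T := GaloisRep.toLocal v (κ.twistModPk ρ hM J) with hT
  have hMk : ∀ x : Fin J → M, p ^ k • x = 0 := fun x => by
    funext i; exact hM (x i)
  -- local duality (2,0), PROVED in the tree
  obtain ⟨-, hcard⟩ := natCard_two_eq_natCard_invariants_homRep F T hMk
  change Nat.card (continuousCohomology 2 T.toTopRep) ≤ _
  rw [hcard]
  -- the endomorphism `g − 1` of `𝒯_J` and its cokernel
  set f0 : Module.End ℤ (Fin J → M) := (T g : (Fin J → M) →ₗ[ℤ] (Fin J → M)) - 1 with hf0
  haveI : Finite (DiscreteGaloisModule.MuCarrier F (p ^ k)) := finite_muCarrier F (p ^ k)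
  haveI : Finite ((Fin J → M) ⧸ LinearMap.range f0) :=
    Finite.of_surjective _ (Submodule.mkQ_surjective _)
  -- `g` acts trivially on `μ_{p^k}`
  have hμ' : ∀ ζ : DiscreteGaloisModule.MuCarrier F (p ^ k),
      DiscreteGaloisModule.mu F (p ^ k) g ζ = ζ := by
    intro ζ
    apply (DiscreteGaloisModule.MuCarrier.toAdditive (K := F)).injective
    rw [DiscreteGaloisModule.mu_apply_apply]
    refine congrArg Additive.ofMul (Subtype.ext ?_)
    rw [absoluteGaloisGroup.coe_smul_rootsOfUnity]
    exact hμ _ ((DiscreteGaloisModule.MuCarrier.toAdditive ζ).toMul).2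
  -- every invariant of `Hom(𝒯_J, μ_{p^k})` kills `(g − 1)𝒯_J`
  have hkill : ∀ f : (T.homRep (DiscreteGaloisModule.mu F (p ^ k))).toTopRep.ρ.invariants,
      LinearMap.range f0 ≤
        LinearMap.ker ((f.1 : (Fin J → M) →+ DiscreteGaloisModule.MuCarrier F (p ^ k)).toIntLinearMap) := by
    rintro f _ ⟨x, rfl⟩
    rw [LinearMap.mem_ker, AddMonoidHom.coe_toIntLinearMap, hf0, LinearMap.sub_apply,
      Module.End.one_apply, map_sub, sub_eq_zero]
    have h := (ContinuousRep.homRep_apply_eq_self_iff T (DiscreteGaloisModule.mu F (p ^ k)) g f.1).1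
      (f.2 g) x
    rw [hμ'] at h
    exact h.symm
  -- so `Hom_Γ(𝒯_J, μ_{p^k}) ↪ Hom(𝒯_J/(g−1), μ_{p^k})`
  have hinj : Nat.card (T.homRep (DiscreteGaloisModule.mu F (p ^ k))).toTopRep.ρ.invariants ≤
      Nat.card (((Fin J → M) ⧸ LinearMap.range f0) →+ DiscreteGaloisModule.MuCarrier F (p ^ k)) := by
    haveI : Finite (((Fin J → M) ⧸ LinearMap.range f0) →+ DiscreteGaloisModule.MuCarrier F (p ^ k)) :=
      Finite.of_injective (fun φ => (φ : _ → DiscreteGaloisModule.MuCarrier F (p ^ k)))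
        DFunLike.coe_injective
    refine Nat.card_le_card_of_injective
      (fun f => ((LinearMap.range f0).liftQ _ (hkill f)).toAddMonoidHom) fun f f' hff' => ?_
    apply Subtype.ext
    apply HomCarrier.ext
    intro x
    have h := DFunLike.congr_fun hff' (Submodule.Quotient.mk x)
    simp only [LinearMap.toAddMonoidHom_coe, Submodule.liftQ_apply, AddMonoidHom.coe_toIntLinearMap] at h
    exact h
  refine hinj.trans ?_
  -- `#Hom(B, μ_{p^k}) ≤ #B = #ker(g − 1) ≤ #M^{p^m}`
  have hΩ : Nat.card (((Fin J → M) ⧸ LinearMap.range f0) →+ DiscreteGaloisModule.MuCarrier F (p ^ k)) =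
      Nat.card (((Fin J → M) ⧸ LinearMap.range f0) →+ ZMod (p ^ k)) :=
    Nat.card_congr (AddEquiv.addMonoidHomCongrRightEquiv (muEquivZMod F (p ^ k)))
  rw [hΩ]
  refine (natCard_addMonoidHom_zmod_le _ (p ^ k)).trans ?_
  rw [← Literature.Algebra.Module.natCard_ker_eq_natCard_quotient_range f0]
  refine le_trans (le_of_eq (Nat.card_congr (Equiv.subtypeEquivRight fun x => ?_)))
    (natCard_fixedPoints_toLocal_twistModPk_le_of_depth ρ hM κ J v hg hgm hgm')
  rw [LinearMap.mem_ker, hf0, LinearMap.sub_apply, Module.End.one_apply, sub_eq_zero]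

end HTwo

/-! ## §3 `#H¹(K_v, 𝒯^{(k)}_J) ≤ #M^{2·p^m}` at `v ∤ p`: the local Euler–Poincaré characteristic (PROVED in the tree
for modules of order prime to the residue characteristic) -/

section HOne

variable {K : Type u} [Field K] [NumberField K] {M : Type u} [AddCommGroup M] [TopologicalSpace M]
  [DiscreteTopology M] [Finite M] (ρ : DiscreteGaloisModule K M) {p : ℕ} [Fact p.Prime] {k : ℕ}
  (hM : ∀ x : M, p ^ k • x = 0) (κ : ZpExtension K p) (J : ℕ) (v : HeightOneSpectrum (𝓞 K))

/-- **Uniform bound on `#H¹(K_v, 𝒯^{(k)}_J)` at a place `v ∤ p`.**  For `g ∈ Γ_{K_v}` with `ρ(res g) = 1`, fixing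
`μ_{p^k}`, of depth `m`, and every level `J`: **`#H¹(K_v, 𝒯^{(k)}_J) ≤ #M^{2·p^m}`** (`#H⁰ · #H² = #H¹` for the
`p`-primary module `𝒯^{(k)}_J` at `v ∤ p`, `natCard_invariants_mul_natCard_two_eq`, with §1 and §2).  The order of
the whole local cohomology at a bad prime is bounded independently of `J` — the input of the uniform local exponent
of the v4 test class (file 2). [cite: MilneADT2006, Ch. I §2, Thm. 2.8 (p. 31)] [cite: SerreGaloisCohomology1997, II §5.7 Thm. 5] -/
theorem natCard_galoisCohomology_one_toLocal_twistModPk_le_of_depth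
    (hpv : (p : 𝓞 K) ∉ v.asIdeal)
    {g : absoluteGaloisGroup (v.adicCompletion K)}
    (hg : ρ (absGaloisRestrict K (v.adicCompletion K) g) = 1)
    (hμ : ∀ ζ : (AlgebraicClosure (v.adicCompletion K))ˣ, ζ ^ (p ^ k) = 1 → g • ζ = ζ) {m : ℕ}
    (hgm : absGaloisRestrict K (v.adicCompletion K) g ∈ κ.layerSubgroup m)
    (hgm' : absGaloisRestrict K (v.adicCompletion K) g ∉ κ.layerSubgroup (m + 1)) :
    Nat.card (galoisCohomology (GaloisRep.toLocal v (κ.twistModPk ρ hM J)) 1) ≤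
      Nat.card M ^ (2 * p ^ m) := by
  set F := v.adicCompletion K
  haveI : CharZero F := charZero_adicCompletion v
  set T := GaloisRep.toLocal v (κ.twistModPk ρ hM J) with hT
  have hprim : IsPrimaryTorsion p (Fin J → M) := fun x => ⟨k, by
    funext i; exact hM (x i)⟩
  obtain ⟨-, hEP⟩ := natCard_invariants_mul_natCard_two_eq F T hprim
    (v.ringChar_residueField_adicCompletion_ne hpv).symm
  change Nat.card (continuousCohomology 1 T.toTopRep) ≤ _
  rw [← hEP, two_mul, pow_add]
  exact Nat.mul_le_mul (natCard_invariants_toLocal_twistModPk_le_of_depth ρ hM κ J v hg hgm hgm')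
    (natCard_galoisCohomology_two_toLocal_twistModPk_le_of_depth ρ hM κ J v hg hμ hgm hgm')

end HOne

end Summit.BirchSwinnertonDyer.BirchSwinnertonDyer.Theorems.OneSidedTwistSqueezeX9KatoDivisibilityX9LocalExponentPk

end
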